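import Literature.MathematicalPhysics.QuantumFieldTheory.Balaban1983to89.B7Prop7OneStepAnalytic
import Literature.MathematicalPhysics.QuantumFieldTheory.Balaban1983to89.B13Contraction113
import Literature.MathematicalPhysics.QuantumFieldTheory.Balaban1983to89.B9Eq315QLipschitz

/-!
# `Balaban1983to89.B9Eq379QLipschitzGeneral` — T. Bałaban, *Propagators for lattice gauge theories in a background field*, Commun. Math. Phys.
# **99** (1985) 389–434 [Balaban1985BackgroundPropagators] (3.79) p. 406 AT A GENERAL BACKGROUND, with [Balaban1985Averaging] Proposition 7 p. 43 and
# (121)–(126) p. 36: THE ONE-STEP VECTOR AVERAGING `Q(V)` IS LIPSCHITZ IN ITS BACKGROUND BETWEEN TWO GENERAL BACKGROUNDS —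
# `‖L(Q(V)A)_c − L(Q(V′)A)_c‖ ≤ K(d,L)·sup_b‖V(b)V′(b)⁻¹ − 1‖·sup_b‖A(b)‖` for a unit-bounded regular `V′` and `V` close to it, for EVERY field size,
# on `ℤ^d` (`linQcov`), on the torus (`QtorusLin`) and on the NE9 chain's weighted `L²` carriers (`QtorusW`)

statement-level skeleton of published theorems with citation tags; proofs where landed; nothing here is a claim
about the Yang–Mills mass gap

CITATION HEADER (lean-in-tree rule 2026-08-18).  Audit cell `pub-balaban`, sub-cell `t4`, NE9 crux team (2): LEAF PROVER 04
(`b2b-balaban-t4-ne9-formalise-leaf-04` gen 73), INTENT I-ne9leaf04-g73-1 (journal `CLAIMS.log` l.42958) = the TWO-BACKGROUND twin of this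
lineage's `B9Eq315QLipschitz` (gen 68; its declared reading (M2): «print's (3.79) is at a general `V` … proved here at `V = 1` only … a
general-`V` comparison of the brackets is not in the tree»), item (i) of the NE9 BINDER-row owner's census (journal l.42142: «two-general-fields
Lipschitz needs two-background twins of (B)∕(ρ′)∕(δ_Q)»).  Sources: [B9] = [Balaban1985BackgroundPropagators] (journal page = PDF page + 388),
p. 406 read by this lineage (gen 68) in the held text `paper:balaban1985-cmp99-background-propagators`; [B7] = [Balaban1985Averaging] Proposition 7
p. 43 and (121)–(126) p. 36 through the verbatim quotations of `B7Prop7OneStep` / `B7Prop7OneStepAnalytic` / `B7Prop3GeneralLinearBound`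
(lit-balaban-r04 / NE7c lineages).  ROUTE = the NE9 owner's CAUCHY ROUTE of `B7Eq123BackgroundModulus` (gen 82, the flat base point), run at
a general regular base point and then once more in the FIELD variable.
Companions (REUSED BY NAME, none modified): `B7Prop7OneStepAnalytic.prop7_oneStep_analyticAt_expCfg` (Prop. 7 for one step: `t ↦ Q(e^{B″(t)}V₀, P(t), c)`
analytic, GENERAL unit-bounded `α`-regular `V₀`), `B7Prop7OneStep.norm_Qcov_cplx_le_crude_explicit` (`‖Q(U″V₀, A, c)‖ ≤ 6144(d+1)L·a` uniformly in the
perturbation) ∕ `norm_bond_expCfg_sub_one_le`, `B13Contraction113.norm_sub_le_of_sphere_bound` (Cauchy + mean value along `[0,1]`), Mathlib's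
`Complex.norm_deriv_le_of_forall_mem_sphere_norm_le` (Cauchy's estimate for the first derivative), `MatrixLog` (`mlog`, `exp_mlog`, `norm_mlog_le_two_mul`),
`B7Prop3Flat` (`expCfg`, `c3`), `B7Prop3GeneralLinear` (`Qcov`, `linQcov`, `Qcov_zero`), `B7Prop1Explicit` (`U1`, `Wcx`), `B9Eq315QTorus` (`perCfg`,
`QtorusLin`, `QtorusW`), `B9Eq315QLipschitz` (`norm_Wcx_sub_one_le`, `norm_apply_le_of_WL2`, `norm_WL2_le_of_pointwise`).

THE PRINT (verbatim).  [B9] p. 406: *«Finally we consider the averaging operator Q(U). … It follows from the explicit formula (124) [5] that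
the averaging operator Q(exp iB V) is an analytic function of B, for B sufficiently small. Moreover this formula implies easily that
Q(exp(iB)V) = Q(V) + F₂(B) and |F₂(B)B′| ≤ O(1) sup|B| Q″|B′| (3.79) where the averages Q″, Q‴_j were introduced in [5] by the formulas (140),
(141). The constant O(1) above depends only on d and L.»* (text layer p0018 L16–L18; v1.2 DOCFIX: v1∕v1.1 printed «sup|B| sup|B′|» and dropped the
`Q″` clause — ne9-leaf-06 g62 X1 ∕ ne9-leaf-01 g77 X50; `Q″` is [B7]'s two-block average (140), `(Q″|B′|)_c ≤ 2d·sup|B′|`).  [B7] p. 43 (as quoted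
in `B7Prop7OneStepAnalytic`): *«Another analyticity result we will need is an analyticity of Q_k(U₀, ηA) with respect to U₀. … Proposition 7. For U₀
satisfying (52) and U′ = e^{iηA′}, |A′| < α₁, α₀, α₁ sufficiently small, the function Q_k(U′U₀, ηA) is analytic in complex variables A′, A, and
Proposition 4 holds uniformly in A′.»*  p. 36 (126) (as quoted in `B7Prop3GeneralLinearBound`): *«|(Q(V₀)A)_c| ≤ |A| + O(1)L²α₀|A| < (1 + O(1)L²α₀)α₁».*

WHY THIS FILE (cell context).  The NE9 chain's chart of the curve species is, today, Lipschitz in the background AT THE FLAT POINT only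
(`Support/NE9CurChartLipschitzAtFlat`, owner gen 82); a chart Lipschitz between TWO GENERAL small-bond backgrounds `U`, `U′` needs every
background letter compared at `U` and `U′` — for the `aQ*Q` term of (3.26)∕(3.82) that is `‖Q(U)x − Q(U′)x‖ ≤ δ_Q(U,U′)‖x‖` with `δ_Q → 0` as
`U → U′`.  This file PROVES that letter — print's `F₂` of (3.79) AT A GENERAL `V` — with the `O(1)` explicit.

WHAT IS PROVED (sorry-free; no `Prop` placeholder; no new definition; hypotheses = the displayed `U1` ∕ regularity ∕ closeness ∕ bound letters).
* §1 `expCfg_zero_mul`, `expCfg_mlog_mul` — the exponential chart between two backgrounds: `e^{log(V V′⁻¹)}·V′ = V` bondwise for `‖V(b)V′(b)⁻¹ − 1‖ < 1`;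
  `norm_mul_inv_sub_one_le` — `‖V(b)V′(b)⁻¹ − 1‖ ≤ ‖V(b) − V′(b)‖` for `V′(b) ∈ U1`.
* §2 **`norm_Qcov_sub_Qcov_le`** — THE TWO-BACKGROUND MODULUS OF THE NONLINEAR ONE-STEP AVERAGE (121): for a unit-bounded base `V′` whose block loops at
  `c` are `α′`-regular (`α′ ≤ 1∕128`), any `V` with `‖V(b)V′(b)⁻¹ − 1‖ ≤ δ ≤ 1∕(12288N)` (`N = (2d+2)L`) and `sup_b‖A(b)‖ ≤ a ≤ c₃(d,L)∕4`:
  `‖Q(V, A, c) − Q(V′, A, c)‖ ≤ 75497472·(d+1)·L·N·δ·a` — the owner's flat-point proof VERBATIM at the base `V′` (the family `τ ↦ Q(e^{τX}V′, A, c)`,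
  `X = log(VV′⁻¹)`, analytic on `|τ| < R = 1∕(4096Nδ)` and bounded there by `6144(d+1)La`; Cauchy on circles of radius `R − 2 ≥ R∕3` around `[0,1]`).
* §3 **`norm_linQcov_sub_linQcov_le`** — [B9] (3.79) AT A GENERAL BACKGROUND: same `V`, `V′`, and `sup_b‖A(b)‖ ≤ a` for ANY `a ≥ 0`:
  `‖L(Q(V)A)_c − L(Q(V′)A)_c‖ ≤ 75497472·(d+1)·L·N·δ·a` — CAUCHY IN THE FIELD VARIABLE: `g(t) = Q(V, tA, c) − Q(V′, tA, c)` is analytic on the closed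
  disc `|t| ≤ ρ := (c₃∕4)∕a` (Prop. 7 with the background perturbation constant in `t`), `‖g‖ ≤ 75497472(d+1)LNδ·(c₃∕4)` on the circle by §2, and
  `L(Q(V)A)_c − L(Q(V′)A)_c = g′(0)` (the linear part (122) IS the derivative at `0` along the ray); the field radius is traded against `a`, so NO
  smallness of the field is needed.
* §4 **`norm_QtorusLin_sub_QtorusLin_le`** — on the torus `TSite d (L·m)` (periodic extensions, `QtorusLin_apply` = `L⁻¹ •` «L(Q(Ũ)Ã)_c»):
  `‖(Q(U)A)(c) − (Q(U′)A)(c)‖ ≤ 75497472·(d+1)·N·δ·sup_b‖A(b)‖`.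
* §5 **`norm_QtorusW_sub_QtorusW_le`** — on the NE9 chain's weighted `L²` carriers (fibre along `φ`, weights `c₀`, `c₁`):
  `‖QtorusW φ U f − QtorusW φ U′ f‖ ≤ M_φ′·M_φ·√(c₁·|Bond(T^{(1)})|∕c₀)·75497472(d+1)Nδ·‖f‖`.
* §6 **`norm_QtorusW_sub_QtorusW_le_of_bonds`** — the same in the chain's SMALL-BOND currency: `U′(b) ∈ U1`, `‖U′(b) − 1‖ ≤ ε′` with
  `2(d+1)L·ε′ ≤ 1∕128` (the base's regularity read off its bonds by `norm_Wcx_sub_one_le`), `‖U(b) − U′(b)‖ ≤ δ ≤ 1∕(12288N)`.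
MODEL / DECLARED READINGS.  (M1) as `B9Eq315QTorus` ∕ `B9Eq315QLipschitz`: `ℤ^d` resp. the torus `TSite d (L·m)` with periodic extension, one averaging
level, `𝔸` a complete normed `ℂ`-algebra with `‖1‖ = 1`; `δ` is ANY bound of `sup_b‖V(b)V′(b)⁻¹ − 1‖` (print's `sup|B|` for `exp(iB)V` vs `V`, up to the
exponential series — §1 converts from `sup_b‖V(b) − V′(b)‖` for unit-bounded `V′`).  (M2′) print's RHS of (3.79) carries the block average `Q″|B′|` of [B7] (140), not `sup|B′|`: since
`(Q″|B′|)_c ≤ 2d·sup_b|B′(b)|`, every statement of this file (sup-currency in the field variable) is an honestly WEAKER reading of (3.79), never a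
stronger one.  (M2) print's (3.79) is an estimate of the LINEAR operator `Q(·)` of
[B9] (3.15) = the linear part «L(Q(·)A)_c» of [B7] (122) up to the normalisation `L` (READING C-adv4-22); §3 is that statement between `V′` and
`V = (VV′⁻¹)V′`; the base must be unit-bounded and regular, the second background only CLOSE to it (no hypothesis of its own).  (M3) constants:
`75497472(d+1)L·N` (`N = (2d+2)L`; per unit `|A|`, un-normalised currency) resp. `∕L` on the torus, `× M_φ′M_φ√(c₁|Bond(T^{(1)})|∕c₀)` on the `L²`
carriers — admissible witnesses of print's «O(1) … depends only on d and L» at a fixed lattice, by the CAUCHY route (crude; not the sharp bracket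
bounds of (124)–(126)); NOT optimal; NOT uniform in the volume `m` on the `L²` carriers (the crude sup ↔ `L²` comparison of `B9Eq315QLipschitz` §6);
the closeness window `δ ≤ 1∕(12288N)` is the analyticity radius' (Prop. 7 through the tree's kernel theorem), not print's.  (M4) at `V′ = 1` §3 is
weaker than `B9Eq315QLipschitz.norm_linQcov_sub_flat_le_of_bonds` (constant `102(d+1)²L²`, no window) — the flat twin stays the better letter there.
HONEST SCOPE.  A finite-lattice continuity estimate; [B7] Prop. 7 is an analyticity STATEMENT, used through the tree's kernel theorem — no inequality
of [B7]∕[B9] asserted; nothing of [B9] Thm 3.11 ∕ (3.80)–(3.86) asserted; ONE displayed letter of a two-general-backgrounds Lipschitz chart of the NE9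
chain, NOT that chart, NOT NE9; NOT summit progress (cell pub-balaban: NE9 NOT PRINTED ∕ NOT PROVED; spine PROVED 0∕9; rung (B)+1 on a finite T⁴ —
NOT infinite volume, NOT mass gap, NOT Clay).  NEW file importing `B7Prop7OneStepAnalytic`, `B13Contraction113`, `B9Eq315QLipschitz`; nothing of the
lit-balaban ∕ NE7c ∕ NE9-owner lineages' files is modified.  Net new unproved facts: 0.
-/

noncomputable section

open scoped BigOperators
open NormedSpace Metric Set

namespace Literature.MathematicalPhysics.QuantumFieldTheory.Balaban1983to89.B9Eq379QLipschitzGeneral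

open B7Prop1Explicit B7Prop3Flat B7Prop3GeneralLinear MatrixLog
open B7Prop7OneStep (norm_Qcov_cplx_le_crude_explicit norm_bond_expCfg_sub_one_le)
open B7Prop7OneStepAnalytic (prop7_oneStep_analyticAt_expCfg)
open B13Contraction113 (norm_sub_le_of_sphere_bound)
open B9Eq315QLipschitz (norm_Wcx_sub_one_le norm_apply_le_of_WL2 norm_WL2_le_of_pointwise)

-- `Site` alone would resolve to the torus sites of `Setup.lean`; re-export the `ℤ^d` sites of `B7Prop1Explicit`.
export B7Prop1Explicit (Site)

variable {d : ℕ} {𝔸 : Type*} [NormedRing 𝔸] [NormedAlgebra ℂ 𝔸] [CompleteSpace 𝔸] [NormOneClass 𝔸]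

/-! ## §1 The exponential chart between two backgrounds: `e^{0}·V′ = V′`, `e^{log(VV′⁻¹)}·V′ = V` -/

omit [NormOneClass 𝔸] in
/-- `e^{0}·V′ = V′` as configurations of units. [cite: Balaban1985Averaging, (109) p.34] -/
theorem expCfg_zero_mul (V' : Site d → Fin d → 𝔸ˣ) : expCfg (0 : Site d → Fin d → 𝔸) * V' = V' := by
  funext x κ
  refine Units.ext ?_
  rw [Pi.mul_apply, Pi.mul_apply, Units.val_mul, expCfg, val_expUnit, Pi.zero_apply, Pi.zero_apply, exp_zero, one_mul]

omit [NormOneClass 𝔸] in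
/-- `e^{log(V V′⁻¹)}·V′ = V` bondwise, for `‖V(b)V′(b)⁻¹ − 1‖ < 1` (the series logarithm (21), `MatrixLog.exp_mlog`) — print's `exp(iB)V` with
`B = (1∕i) log(VV′⁻¹)`. [cite: Balaban1985Averaging, (21)–(27) pp.21–22; Balaban1985BackgroundPropagators, (3.79) p.406] -/
theorem expCfg_mlog_mul (V V' : Site d → Fin d → 𝔸ˣ) (hV : ∀ x κ, ‖((V x κ : 𝔸ˣ) : 𝔸) * (((V' x κ)⁻¹ : 𝔸ˣ) : 𝔸) - 1‖ < 1) :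
    expCfg (fun x κ => mlog (((V x κ : 𝔸ˣ) : 𝔸) * (((V' x κ)⁻¹ : 𝔸ˣ) : 𝔸))) * V' = V := by
  funext x κ
  refine Units.ext ?_
  rw [Pi.mul_apply, Pi.mul_apply, Units.val_mul, expCfg, val_expUnit, exp_mlog (hV x κ), mul_assoc, Units.inv_mul, mul_one]

omit [NormedAlgebra ℂ 𝔸] [CompleteSpace 𝔸] in
/-- `‖uu′⁻¹ − 1‖ ≤ ‖u − u′‖` for `u′ ∈ U1` (`uu′⁻¹ − 1 = (u − u′)u′⁻¹`, `‖u′⁻¹‖ ≤ 1`): the closeness letter of §2–§5 from the bondwise distance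
(used in §6). [folklore] -/
private theorem norm_mul_inv_sub_one_le {u u' : 𝔸ˣ} (hu' : u' ∈ U1 𝔸) :
    ‖(u : 𝔸) * ((u'⁻¹ : 𝔸ˣ) : 𝔸) - 1‖ ≤ ‖(u : 𝔸) - (u' : 𝔸)‖ := by
  have h : (u : 𝔸) * ((u'⁻¹ : 𝔸ˣ) : 𝔸) - 1 = ((u : 𝔸) - (u' : 𝔸)) * ((u'⁻¹ : 𝔸ˣ) : 𝔸) := by
    rw [sub_mul, Units.mul_inv]
  rw [h]
  exact (norm_mul_le _ _).trans (mul_le_of_le_one_right (norm_nonneg _) (mem_U1.1 hu').2)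

/-! ## §2 The nonlinear one-step average (121) between two backgrounds -/

/-- **`‖Q(V, A, c) − Q(V′, A, c)‖ ≤ 75497472·(d+1)·L·N·δ·a`** (`N = (2d+2)L`) for a unit-bounded base `V′` with `α′`-regular block loops at `c`
(`α′ ≤ 1∕128`), a background `V` with `‖V(b)V′(b)⁻¹ − 1‖ ≤ δ ≤ 1∕(12288N)` and a field `|A| ≤ a ≤ c₃(d,L)∕4` — Prop. 7's analyticity in the
background read as a LIPSCHITZ MODULUS AT THE BASE `V′` by a Cauchy estimate along `τ ↦ e^{τ log(VV′⁻¹)}V′` (analytic on `|τ| < 1∕(4096Nδ)` with the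
sup bound `6144(d+1)La` of `B7Prop7OneStep`; circles of radius `R − 2` around `[0,1]`); the NE9 owner's flat-point argument
(`B7Eq123BackgroundModulus.norm_Qcov_sub_flat_le`) verbatim at a general base. [cite: Balaban1985Averaging, Proposition 7 p.43, (121)–(126) p.36] -/
theorem norm_Qcov_sub_Qcov_le {L : ℕ} (hL : 1 ≤ L) {V V' : Site d → Fin d → 𝔸ˣ} (hV' : ∀ x κ, V' x κ ∈ U1 𝔸)
    (q : Site d) (κ : Fin d) {α' : ℝ} (hα1' : α' ≤ 1 / 128)
    (hreg' : ∀ r : Fin d → Fin L, ‖((Wcx L V' q κ (boxVec L r) : 𝔸ˣ) : 𝔸) - 1‖ ≤ α')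
    {δ : ℝ} (hδ : 0 ≤ δ) (hδmax : δ ≤ 1 / (12288 * ((2 * (d * L) + L + L : ℕ) : ℝ)))
    (hVδ : ∀ x κ, ‖((V x κ : 𝔸ˣ) : 𝔸) * (((V' x κ)⁻¹ : 𝔸ˣ) : 𝔸) - 1‖ ≤ δ)
    (A : Site d → Fin d → 𝔸) {a : ℝ} (ha : 0 ≤ a) (hA : ∀ x κ, ‖A x κ‖ ≤ a) (hac : a ≤ c3 d L / 4) :
    ‖Qcov L V A q κ - Qcov L V' A q κ‖ ≤
      75497472 * ((d : ℝ) + 1) * L * ((2 * (d * L) + L + L : ℕ) : ℝ) * δ * a := by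
  set N : ℝ := ((2 * (d * L) + L + L : ℕ) : ℝ) with hNdef
  have hN1 : (1 : ℝ) ≤ N := by
    have : 1 ≤ 2 * (d * L) + L + L := by omega
    rw [hNdef]; exact_mod_cast this
  have hN : 0 < N := by linarith
  rcases hδ.eq_or_lt with h0 | hpos
  · -- `δ = 0`: the two backgrounds COINCIDE
    have hV1 : V = V' := by
      funext x κ'
      have h := hVδ x κ'
      rw [← h0] at h
      have h' : ((V x κ' : 𝔸ˣ) : 𝔸) * (((V' x κ')⁻¹ : 𝔸ˣ) : 𝔸) = 1 := by
        simpa [sub_eq_zero] using norm_le_zero_iff.1 h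
      exact Units.ext (by
        have := congrArg (fun z : 𝔸 => z * ((V' x κ' : 𝔸ˣ) : 𝔸)) h'
        simpa [mul_assoc] using this)
    rw [hV1, sub_self, norm_zero, ← h0]; positivity
  -- the logarithms of the bond quotients
  have hδ2 : δ ≤ 1 / 2 := hδmax.trans (by
    rw [div_le_div_iff₀ (by positivity) (by norm_num)]; nlinarith)
  set X : Site d → Fin d → 𝔸 := fun x κ => mlog (((V x κ : 𝔸ˣ) : 𝔸) * (((V' x κ)⁻¹ : 𝔸ˣ) : 𝔸)) with hXdef
  have hX : ∀ x κ', ‖X x κ'‖ ≤ 2 * δ := fun x κ' =>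
    (norm_mlog_le_two_mul ((hVδ x κ').trans hδ2)).trans (by linarith [hVδ x κ'])
  have hVexp : expCfg X * V' = V := expCfg_mlog_mul V V' fun x κ' => (hVδ x κ').trans_lt (by linarith)
  -- the radius of analyticity in the background variable
  set R : ℝ := 1 / (4096 * N * δ) with hRdef
  have hR : 0 < R := by rw [hRdef]; positivity
  have hR3 : 3 ≤ R := by
    rw [hRdef, le_div_iff₀ (by positivity)]
    have := mul_le_mul_of_nonneg_left hδmax (by positivity : (0 : ℝ) ≤ 12288 * N)
    rw [mul_one_div_cancel (by positivity)] at this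
    nlinarith
  have hRδ : R * δ = 1 / (4096 * N) := by rw [hRdef]; field_simp
  -- the family `h(τ) = Q(e^{τX}·V′, A, c)`
  set h : ℂ → 𝔸 := fun τ => Qcov L (expCfg (τ • X) * V') A q κ with hhdef
  have h1 : h 1 = Qcov L V A q κ := by
    simp only [hhdef, one_smul, hVexp]
  have h0' : h 0 = Qcov L V' A q κ := by
    simp only [hhdef, zero_smul, expCfg_zero_mul]
  -- bond sizes of `τ • X` on the disc
  have hτX : ∀ τ : ℂ, ‖τ‖ < R → ∀ x κ', ‖(τ • X) x κ'‖ ≤ 2 * R * δ := fun τ hτ x κ' => by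
    rw [Pi.smul_apply, Pi.smul_apply, norm_smul]
    calc ‖τ‖ * ‖X x κ'‖ ≤ R * (2 * δ) := mul_le_mul hτ.le (hX x κ') (norm_nonneg _) hR.le
      _ = 2 * R * δ := by ring
  have h2Rδ : 2 * R * δ = 1 / (2048 * N) := by rw [mul_assoc, hRδ]; field_simp; norm_num
  have hNa : N * a ≤ 1 / 256 := by
    have hL0 : (0 : ℝ) < L := by exact_mod_cast hL
    have hc3 : c3 d L / 4 = 1 / (512 * ((d : ℝ) + 1) * L) := by rw [c3]; field_simp; ring
    have hNle : N ≤ 2 * ((d : ℝ) + 1) * L := by rw [hNdef]; push_cast; nlinarith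
    calc N * a ≤ 2 * ((d : ℝ) + 1) * L * (1 / (512 * ((d : ℝ) + 1) * L)) :=
          mul_le_mul hNle (hac.trans (le_of_eq hc3)) ha (by positivity)
      _ = 1 / 256 := by field_simp; ring
  -- analyticity on the disc
  have hd : DifferentiableOn ℂ h (ball (0 : ℂ) R) := fun τ hτ => by
    rw [mem_ball_zero_iff] at hτ
    have han := prop7_oneStep_analyticAt_expCfg (E := ℂ) hL hV'
      (fun t : ℂ => t • X) (t₀ := τ) (fun x κ' => (analyticAt_id.smul analyticAt_const : AnalyticAt ℂ (fun t : ℂ => t • X x κ') τ))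
      (fun _ : ℂ => A) (fun x κ' => analyticAt_const) ha hA (a'' := 2 * R * δ) (by positivity) (hτX τ hτ)
      (θ := 1 / 128) (by
        rw [h2Rδ]
        show N * (a + 4 * (1 / (2048 * N))) ≤ 1 / 128
        have e : N * (4 * (1 / (2048 * N))) = 1 / 512 := by field_simp; ring
        nlinarith [hNa, e]) (by norm_num) le_rfl q κ hα1' hreg'
    exact han.differentiableAt.differentiableWithinAt
  -- the sup bound on the disc, uniform in the perturbation
  have hM : ∀ τ : ℂ, ‖τ‖ < R → ‖h τ‖ ≤ 6144 * ((d : ℝ) + 1) * L * a := fun τ hτ => by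
    have hu1 : 2 * R * δ ≤ 1 / 64 := by rw [h2Rδ, div_le_div_iff₀ (by positivity) (by norm_num)]; nlinarith
    have hexp : Real.exp (2 * R * δ) - 1 ≤ 2 * (2 * R * δ) := exp_sub_one_le_of_le le_rfl (by positivity) hu1
    have hU : ∀ x κ', ‖((expCfg (τ • X) x κ' : 𝔸ˣ) : 𝔸) - 1‖ ≤ 2 * (2 * R * δ) ∧
        ‖(((expCfg (τ • X) x κ')⁻¹ : 𝔸ˣ) : 𝔸) - 1‖ ≤ 2 * (2 * R * δ) := fun x κ' =>
      ⟨(norm_bond_expCfg_sub_one_le _ (hτX τ hτ) x κ').1.trans hexp, (norm_bond_expCfg_sub_one_le _ (hτX τ hτ) x κ').2.trans hexp⟩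
    have hun : N * (2 * (2 * R * δ)) ≤ 1 / 512 := by rw [h2Rδ]; field_simp; nlinarith
    exact (norm_Qcov_cplx_le_crude_explicit hL (V₀ := V') hV' (by positivity) hU
      (by rw [hNdef] at hun; exact hun) A ha hA hac q κ hα1' hreg').2
  -- Cauchy on circles of radius `R − 2` around `[0, 1]`
  have hr : 0 < R - 2 := by linarith
  have hsub : ∀ t : ℝ, t ∈ Icc (0 : ℝ) 1 → closedBall (t : ℂ) (R - 2) ⊆ ball (0 : ℂ) R := fun t ht z hz => by
    rw [mem_closedBall, dist_eq_norm] at hz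
    rw [mem_ball_zero_iff]
    have ht1 : ‖(t : ℂ)‖ ≤ 1 := by rw [Complex.norm_real, Real.norm_of_nonneg ht.1]; exact ht.2
    calc ‖z‖ = ‖(z - t) + t‖ := by rw [sub_add_cancel]
      _ ≤ ‖z - (t : ℂ)‖ + ‖(t : ℂ)‖ := norm_add_le _ _
      _ < R := by linarith
  have hMs : ∀ t : ℝ, t ∈ Icc (0 : ℝ) 1 → ∀ z ∈ sphere (t : ℂ) (R - 2), ‖h z‖ ≤ 6144 * ((d : ℝ) + 1) * L * a := fun t ht z hz =>
    hM z (mem_ball_zero_iff.1 (hsub t ht (sphere_subset_closedBall hz)))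
  have hC := norm_sub_le_of_sphere_bound isOpen_ball hd hr hsub hMs
  rw [h1, h0'] at hC
  refine hC.trans ?_
  -- `M∕(R − 2) ≤ 3M∕R = 3M·4096Nδ`
  have hR2 : R / 3 ≤ R - 2 := by linarith
  have hMnn : 0 ≤ 6144 * ((d : ℝ) + 1) * L * a := by positivity
  calc 6144 * ((d : ℝ) + 1) * L * a / (R - 2) ≤ 6144 * ((d : ℝ) + 1) * L * a / (R / 3) :=
        div_le_div_of_nonneg_left hMnn (by positivity) hR2
    _ = 75497472 * ((d : ℝ) + 1) * L * N * δ * a := by rw [hRdef]; field_simp; ring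

/-! ## §3 [B9] (3.79) at a general background: the LINEAR part between two backgrounds, for every field size -/

omit [NormOneClass 𝔸] in
/-- the linear part (122) of the zero field vanishes (`Q(V, t·0, c) = Q(V, 0, c) = 0` for all `t`). [cite: Balaban1985Averaging, (121)–(122) p.36] -/
theorem linQcov_zero_field (L : ℕ) (V : Site d → Fin d → 𝔸ˣ) (q : Site d) (κ : Fin d) :
    linQcov L V (0 : Site d → Fin d → 𝔸) q κ = 0 := by
  unfold linQcov
  simp only [smul_zero, Qcov_zero, deriv_const]

/-- **[B9] (3.79) AT A GENERAL BACKGROUND — `‖L(Q(V)A)_c − L(Q(V′)A)_c‖ ≤ 75497472·(d+1)·L·N·δ·a` for EVERY field size `a`.**  For a unit-bounded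
base `V′` with `α′`-regular block loops at `c` (`α′ ≤ 1∕128`) and a background `V` with `‖V(b)V′(b)⁻¹ − 1‖ ≤ δ ≤ 1∕(12288N)` («Q(exp(iB)V) = Q(V) + F₂(B)
and |F₂(B)B′| ≤ O(1) sup|B| sup|B′| … The constant O(1) above depends only on d and L»; here `exp(iB) = VV′⁻¹`, `B′ = A`): CAUCHY IN THE FIELD
VARIABLE — `g(t) = Q(V, tA, c) − Q(V′, tA, c)` is analytic on `|t| ≤ ρ = (c₃∕4)∕a` (Prop. 7, the background perturbation constant in `t`), bounded by
`75497472(d+1)LNδ·(c₃∕4)` on the circle `|t| = ρ` (§2 at the field `tA`), and the linear parts are `g′(0)` — `‖g′(0)‖ ≤ sup_{|t|=ρ}‖g‖∕ρ`.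
[cite: Balaban1985BackgroundPropagators, (3.79) p.406; Balaban1985Averaging, Proposition 7 p.43, (122) p.36, (126) p.36] -/
theorem norm_linQcov_sub_linQcov_le {L : ℕ} (hL : 1 ≤ L) {V V' : Site d → Fin d → 𝔸ˣ} (hV' : ∀ x κ, V' x κ ∈ U1 𝔸)
    (q : Site d) (κ : Fin d) {α' : ℝ} (hα1' : α' ≤ 1 / 128)
    (hreg' : ∀ r : Fin d → Fin L, ‖((Wcx L V' q κ (boxVec L r) : 𝔸ˣ) : 𝔸) - 1‖ ≤ α')
    {δ : ℝ} (hδ : 0 ≤ δ) (hδmax : δ ≤ 1 / (12288 * ((2 * (d * L) + L + L : ℕ) : ℝ)))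
    (hVδ : ∀ x κ, ‖((V x κ : 𝔸ˣ) : 𝔸) * (((V' x κ)⁻¹ : 𝔸ˣ) : 𝔸) - 1‖ ≤ δ)
    (A : Site d → Fin d → 𝔸) {a : ℝ} (ha : 0 ≤ a) (hA : ∀ x κ, ‖A x κ‖ ≤ a) :
    ‖linQcov L V A q κ - linQcov L V' A q κ‖ ≤
      75497472 * ((d : ℝ) + 1) * L * ((2 * (d * L) + L + L : ℕ) : ℝ) * δ * a := by
  set N : ℝ := ((2 * (d * L) + L + L : ℕ) : ℝ) with hNdef
  have hN1 : (1 : ℝ) ≤ N := by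
    have : 1 ≤ 2 * (d * L) + L + L := by omega
    rw [hNdef]; exact_mod_cast this
  have hN : 0 < N := by linarith
  have hL0 : (0 : ℝ) < L := by exact_mod_cast hL
  rcases ha.eq_or_lt with h0 | hapos
  · -- `a = 0`: the field vanishes and so do both linear parts
    have hA0 : A = 0 := by
      funext x κ'
      have h := hA x κ'
      rw [← h0] at h
      exact norm_le_zero_iff.1 h
    rw [hA0, linQcov_zero_field, linQcov_zero_field, sub_self, norm_zero, ← h0]; positivity
  -- the logarithms of the bond quotients (the background perturbation, CONSTANT in the field variable)
  have hδ2 : δ ≤ 1 / 2 := hδmax.trans (by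
    rw [div_le_div_iff₀ (by positivity) (by norm_num)]; nlinarith)
  set X : Site d → Fin d → 𝔸 := fun x κ => mlog (((V x κ : 𝔸ˣ) : 𝔸) * (((V' x κ)⁻¹ : 𝔸ˣ) : 𝔸)) with hXdef
  have hX : ∀ x κ', ‖X x κ'‖ ≤ 2 * δ := fun x κ' =>
    (norm_mlog_le_two_mul ((hVδ x κ').trans hδ2)).trans (by linarith [hVδ x κ'])
  have hVexp : expCfg X * V' = V := expCfg_mlog_mul V V' fun x κ' => (hVδ x κ').trans_lt (by linarith)
  have h8Nδ : N * (4 * (2 * δ)) ≤ 1 / 1536 := by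
    have := mul_le_mul_of_nonneg_left hδmax (by positivity : (0 : ℝ) ≤ 8 * N)
    have e : 8 * N * (1 / (12288 * N)) = 1 / 1536 := by field_simp; ring
    nlinarith [e]
  -- the field radius `ρ = (c₃∕4)∕a` and the field size `a₀ = c₃∕4` on the closed disc
  set a₀ : ℝ := c3 d L / 4 with ha₀def
  have ha₀ : 0 < a₀ := by rw [ha₀def, c3]; positivity
  have hNa₀ : N * a₀ ≤ 1 / 256 := by
    have hc3 : a₀ = 1 / (512 * ((d : ℝ) + 1) * L) := by rw [ha₀def, c3]; field_simp; ring
    have hNle : N ≤ 2 * ((d : ℝ) + 1) * L := by rw [hNdef]; push_cast; nlinarith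
    calc N * a₀ ≤ 2 * ((d : ℝ) + 1) * L * (1 / (512 * ((d : ℝ) + 1) * L)) :=
          mul_le_mul hNle hc3.le ha₀.le (by positivity)
      _ = 1 / 256 := by field_simp; ring
  set ρ : ℝ := a₀ / a with hρdef
  have hρ : 0 < ρ := div_pos ha₀ hapos
  have hρa : ρ * a = a₀ := by rw [hρdef]; field_simp
  have htA : ∀ t : ℂ, ‖t‖ ≤ ρ → ∀ x κ', ‖(t • A) x κ'‖ ≤ a₀ := fun t ht x κ' => by
    rw [Pi.smul_apply, Pi.smul_apply, norm_smul]
    calc ‖t‖ * ‖A x κ'‖ ≤ ρ * a := mul_le_mul ht (hA x κ') (norm_nonneg _) hρ.le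
      _ = a₀ := hρa
  -- Prop. 7 at every point of the closed disc, for the base `V′` perturbed by the CONSTANT `e^{X}` (= `V`) resp. by `e^{0}` (= `V′`)
  have hθ : N * (a₀ + 4 * (2 * δ)) ≤ 1 / 128 := by nlinarith [hNa₀, h8Nδ]
  have hanV : ∀ t : ℂ, ‖t‖ ≤ ρ → AnalyticAt ℂ (fun s : ℂ => Qcov L V (s • A) q κ) t := fun t ht => by
    have han := prop7_oneStep_analyticAt_expCfg (E := ℂ) hL hV'
      (fun _ : ℂ => X) (t₀ := t) (fun x κ' => analyticAt_const)
      (fun s : ℂ => s • A) (fun x κ' => (analyticAt_id.smul analyticAt_const : AnalyticAt ℂ (fun s : ℂ => s • A x κ') t))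
      ha₀.le (htA t ht) (a'' := 2 * δ) (by positivity) hX (θ := 1 / 128) hθ (by norm_num) le_rfl q κ hα1' hreg'
    simpa only [hVexp] using han
  have hanV' : ∀ t : ℂ, ‖t‖ ≤ ρ → AnalyticAt ℂ (fun s : ℂ => Qcov L V' (s • A) q κ) t := fun t ht => by
    have hX0 : ∀ x κ', ‖(0 : Site d → Fin d → 𝔸) x κ'‖ ≤ 2 * δ := fun x κ' => by
      rw [Pi.zero_apply, Pi.zero_apply, norm_zero]; positivity
    have han := prop7_oneStep_analyticAt_expCfg (E := ℂ) hL hV'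
      (fun _ : ℂ => (0 : Site d → Fin d → 𝔸)) (t₀ := t) (fun x κ' => analyticAt_const)
      (fun s : ℂ => s • A) (fun x κ' => (analyticAt_id.smul analyticAt_const : AnalyticAt ℂ (fun s : ℂ => s • A x κ') t))
      ha₀.le (htA t ht) (a'' := 2 * δ) (by positivity) hX0 (θ := 1 / 128) hθ (by norm_num) le_rfl q κ hα1' hreg'
    simpa only [expCfg_zero_mul] using han
  -- the difference `g`, complex-differentiable on the closed disc
  set g : ℂ → 𝔸 := fun s => Qcov L V (s • A) q κ - Qcov L V' (s • A) q κ with hgdef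
  have hdiff : DifferentiableOn ℂ g (closedBall (0 : ℂ) ρ) := fun t ht => by
    rw [mem_closedBall_zero_iff] at ht
    exact ((hanV t ht).differentiableAt.sub (hanV' t ht).differentiableAt).differentiableWithinAt
  have hdc : DiffContOnCl ℂ g (ball (0 : ℂ) ρ) := hdiff.diffContOnCl_ball subset_rfl
  -- the bound on the circle `|t| = ρ`: §2 at the field `tA` (size `a₀ = c₃∕4`)
  have hsph : ∀ z ∈ sphere (0 : ℂ) ρ, ‖g z‖ ≤ 75497472 * ((d : ℝ) + 1) * L * N * δ * a₀ := fun z hz => by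
    have hz' : ‖z‖ ≤ ρ := (mem_sphere_zero_iff_norm.1 hz).le
    exact norm_Qcov_sub_Qcov_le hL hV' q κ hα1' hreg' hδ hδmax hVδ (z • A) ha₀.le (htA z hz') le_rfl
  have hC := Complex.norm_deriv_le_of_forall_mem_sphere_norm_le hρ hdc hsph
  -- the linear parts are the derivatives at `0`
  have hderiv : deriv g 0 = linQcov L V A q κ - linQcov L V' A q κ := by
    have h0ρ : ‖(0 : ℂ)‖ ≤ ρ := by rw [norm_zero]; exact hρ.le
    rw [hgdef]
    exact deriv_fun_sub (hanV 0 h0ρ).differentiableAt (hanV' 0 h0ρ).differentiableAt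
  rw [← hderiv]
  refine hC.trans (le_of_eq ?_)
  rw [hρdef]
  field_simp

/-! ## §4 On the torus: `Q(U)` of [B9] (3.15) (`B9Eq315QTorus.QtorusLin`) between two backgrounds -/

section Torus

open B4Sect5Torus (TSite)
open B9SectCLatticeCarrier (Bond)
open B9Eq319QprimeTorus (fineP)
open B9Eq311L2Pairing (WL2)
open B11Eq103H1Complex (BondL2K)
open B9Eq315QTorus (perCfg perSite cornerSite QtorusLin QtorusLin_apply QtorusW QtorusW_apply)

variable (L : ℕ) (m : Fin d → ℕ) [∀ i, NeZero (fineP L m i)] (hL : 1 ≤ L)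
  (U : Bond d (fineP L m) → 𝔸ˣ) {α : ℝ} (hα1 : α ≤ 1 / 64)
  (hU1 : ∀ (x : Site d) (κ : Fin d), perCfg (fineP L m) U x κ ∈ U1 𝔸)
  (hreg : ∀ (y : TSite d m) (κ : Fin d) (r : Fin d → Fin L),
    ‖((Wcx L (perCfg (fineP L m) U) (cornerSite L y) κ (boxVec L r) : 𝔸ˣ) : 𝔸) - 1‖ ≤ α)
  (U' : Bond d (fineP L m) → 𝔸ˣ) {α' : ℝ} (hα1' : α' ≤ 1 / 64)
  (hU1' : ∀ (x : Site d) (κ : Fin d), perCfg (fineP L m) U' x κ ∈ U1 𝔸)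
  (hreg' : ∀ (y : TSite d m) (κ : Fin d) (r : Fin d → Fin L),
    ‖((Wcx L (perCfg (fineP L m) U') (cornerSite L y) κ (boxVec L r) : 𝔸ˣ) : 𝔸) - 1‖ ≤ α')
  (hα' : α' ≤ 1 / 128)
  {δ : ℝ} (hδ : 0 ≤ δ) (hδmax : δ ≤ 1 / (12288 * ((2 * (d * L) + L + L : ℕ) : ℝ)))
  (hUδ : ∀ b : Bond d (fineP L m), ‖((U b : 𝔸ˣ) : 𝔸) * (((U' b)⁻¹ : 𝔸ˣ) : 𝔸) - 1‖ ≤ δ)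

include hα' hδ hδmax hUδ in
/-- **`Q(U)` ON THE TORUS IS LIPSCHITZ IN `U` BETWEEN TWO BACKGROUNDS** (per coarse bond, sup norm on the fine bonds): for the base `U′` (unit-bounded,
`α′`-regular extended block loops with `α′ ≤ 1∕128`) and `U` with `‖U(b)U′(b)⁻¹ − 1‖ ≤ δ ≤ 1∕(12288N)`,
`‖(Q(U)A)(c) − (Q(U′)A)(c)‖ ≤ 75497472·(d+1)·N·δ·sup_b‖A(b)‖` — §3 on the periodic extensions (`QtorusLin_apply` = `L⁻¹ •` «L(Q(Ũ)Ã)_c»; the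
regularity letters of `U` are `QtorusLin`'s own and play no role).  The two-background `δ_Q`-letter of the NE9 chain (`‖Q(U)x − Q(U′)x‖ ≤ δ_Q‖x‖`),
finite-lattice constants. [cite: Balaban1985BackgroundPropagators, (3.15) p.393, (3.78)–(3.79) p.406; Balaban1985Averaging, Proposition 7 p.43] -/
theorem norm_QtorusLin_sub_QtorusLin_le (A : Bond d (fineP L m) → 𝔸) {a : ℝ} (hA : ∀ b, ‖A b‖ ≤ a) (c : Bond d m) :
    ‖QtorusLin L m hL U hα1 hU1 hreg A c - QtorusLin L m hL U' hα1' hU1' hreg' A c‖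
      ≤ 75497472 * ((d : ℝ) + 1) * ((2 * (d * L) + L + L : ℕ) : ℝ) * δ * a := by
  have hLpos : (0 : ℝ) < L := by exact_mod_cast hL
  have ha : 0 ≤ a := (norm_nonneg _).trans (hA (perSite (fineP L m) 0, c.2))
  have hAp : ∀ (x : Site d) (κ : Fin d), ‖perCfg (fineP L m) A x κ‖ ≤ a := fun x κ => hA _
  have hUp : ∀ (x : Site d) (κ : Fin d),
      ‖((perCfg (fineP L m) U x κ : 𝔸ˣ) : 𝔸) * (((perCfg (fineP L m) U' x κ)⁻¹ : 𝔸ˣ) : 𝔸) - 1‖ ≤ δ := fun x κ => hUδ _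
  have h := norm_linQcov_sub_linQcov_le hL (V := perCfg (fineP L m) U) hU1' (cornerSite L c.1) c.2 hα' (hreg' c.1 c.2)
    hδ hδmax hUp (perCfg (fineP L m) A) ha hAp
  rw [QtorusLin_apply, QtorusLin_apply, ← smul_sub, norm_smul, norm_inv, Complex.norm_natCast, inv_mul_le_iff₀ hLpos]
  exact h.trans (le_of_eq (by ring))

/-! ## §5 On the chain's weighted `L²` carriers: `QtorusW φ U` against `QtorusW φ U′` -/

variable {W : Type*} [NormedAddCommGroup W] [InnerProductSpace ℂ W] (φ : W ≃ₗ[ℂ] 𝔸) {c₀ c₁ : ℝ} [Fact (0 < c₀)] [Fact (0 < c₁)]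
  {Mφ Mφ' : ℝ} (hMφ : 0 ≤ Mφ) (hφ : ∀ w, ‖φ w‖ ≤ Mφ * ‖w‖) (hMφ' : 0 ≤ Mφ') (hφ' : ∀ X, ‖φ.symm X‖ ≤ Mφ' * ‖X‖)

include hα' hδ hδmax hUδ hMφ hφ hMφ' hφ' in
/-- **THE TWO-BACKGROUND `δ_Q`-LETTER ON THE NE9 CHAIN'S CARRIERS**: `Q(·)` read on the weighted `L²` spaces of `W`-valued bond functions (fibre along `φ`,
fine weight `c₀`, coarse weight `c₁`; `B9Eq315QTorus.QtorusW`) is Lipschitz in the background between `U′` (unit-bounded, `α′ ≤ 1∕128`-regular) and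
`U` (`‖U(b)U′(b)⁻¹ − 1‖ ≤ δ ≤ 1∕(12288N)`): `‖Q(U)f − Q(U′)f‖ ≤ M_φ′·M_φ·√(c₁·|bonds of T^{(1)}|∕c₀)·75497472(d+1)N·δ·‖f‖` — §4 at the `𝔸`-valued
function `b ↦ φ(f(b))` (sup `≤ M_φ‖f‖∕√c₀`), read back along `φ⁻¹` and summed with the coarse weight (the transfer of `B9Eq315QLipschitz` §6).
Finite-lattice constants (non-uniform in `L`, `m`). [cite: Balaban1985BackgroundPropagators, (3.15)–(3.16) p.393, (3.78)–(3.79) p.406, (3.82) p.407; Balaban1985Averaging, Proposition 7 p.43] -/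
theorem norm_QtorusW_sub_QtorusW_le (f : BondL2K ℂ d (fineP L m) c₀ W) :
    ‖QtorusW L m hL φ U hα1 hU1 hreg (c₁ := c₁) f - QtorusW L m hL φ U' hα1' hU1' hreg' (c₁ := c₁) f‖
      ≤ Mφ' * Mφ * Real.sqrt (c₁ * Fintype.card (Bond d m) / c₀) *
          (75497472 * ((d : ℝ) + 1) * ((2 * (d * L) + L + L : ℕ) : ℝ) * δ) * ‖f‖ := by
  have hc₀ : 0 < c₀ := Fact.out
  set g : Bond d (fineP L m) → 𝔸 := fun b => φ (WL2.equiv ℂ _ W f b) with hg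
  set a : ℝ := Mφ * (‖f‖ / Real.sqrt c₀) with ha_def
  have ha0 : 0 ≤ a := mul_nonneg hMφ (div_nonneg (norm_nonneg f) (Real.sqrt_nonneg _))
  have ha : ∀ b, ‖g b‖ ≤ a := fun b => (hφ _).trans (mul_le_mul_of_nonneg_left (norm_apply_le_of_WL2 f b) hMφ)
  have hpt : ∀ c : Bond d m,
      ‖WL2.equiv ℂ _ W (QtorusW L m hL φ U hα1 hU1 hreg (c₁ := c₁) f
          - QtorusW L m hL φ U' hα1' hU1' hreg' (c₁ := c₁) f) c‖
        ≤ Mφ' * (75497472 * ((d : ℝ) + 1) * ((2 * (d * L) + L + L : ℕ) : ℝ) * δ * a) := by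
    intro c
    rw [WL2.equiv_sub, Pi.sub_apply, QtorusW_apply, QtorusW_apply, ← map_sub]
    exact (hφ' _).trans (mul_le_mul_of_nonneg_left
      (norm_QtorusLin_sub_QtorusLin_le L m hL U hα1 hU1 hreg U' hα1' hU1' hreg' hα' hδ hδmax hUδ g ha c) hMφ')
  have hB0 : 0 ≤ Mφ' * (75497472 * ((d : ℝ) + 1) * ((2 * (d * L) + L + L : ℕ) : ℝ) * δ * a) := by positivity
  refine (norm_WL2_le_of_pointwise _ hB0 hpt).trans (le_of_eq ?_)
  rw [ha_def, Real.sqrt_div' _ hc₀.le]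
  ring

end Torus

/-! ## §6 In the chain's small-bond currency: both backgrounds in the ball of bonds near `1` -/

section SmallBonds

open B4Sect5Torus (TSite)
open B9SectCLatticeCarrier (Bond)
open B9Eq319QprimeTorus (fineP)
open B9Eq311L2Pairing (WL2)
open B11Eq103H1Complex (BondL2K)
open B9Eq315QTorus (perCfg perCfg_apply perSite cornerSite QtorusLin QtorusLin_apply QtorusW QtorusW_apply)

variable (L : ℕ) (m : Fin d → ℕ) [∀ i, NeZero (fineP L m i)] (hL : 1 ≤ L)
  (U : Bond d (fineP L m) → 𝔸ˣ) {α : ℝ} (hα1 : α ≤ 1 / 64)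
  (hU1 : ∀ (x : Site d) (κ : Fin d), perCfg (fineP L m) U x κ ∈ U1 𝔸)
  (hreg : ∀ (y : TSite d m) (κ : Fin d) (r : Fin d → Fin L),
    ‖((Wcx L (perCfg (fineP L m) U) (cornerSite L y) κ (boxVec L r) : 𝔸ˣ) : 𝔸) - 1‖ ≤ α)
  (U' : Bond d (fineP L m) → 𝔸ˣ) {α' : ℝ} (hα1' : α' ≤ 1 / 64)
  (hU1' : ∀ (x : Site d) (κ : Fin d), perCfg (fineP L m) U' x κ ∈ U1 𝔸)
  (hreg' : ∀ (y : TSite d m) (κ : Fin d) (r : Fin d → Fin L),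
    ‖((Wcx L (perCfg (fineP L m) U') (cornerSite L y) κ (boxVec L r) : 𝔸ˣ) : 𝔸) - 1‖ ≤ α')
  {ε' : ℝ} (hε' : 0 ≤ ε') (hU'ε : ∀ b : Bond d (fineP L m), ‖((U' b : 𝔸ˣ) : 𝔸) - 1‖ ≤ ε')
  (hε'reg : 2 * ((d : ℝ) + 1) * L * ε' ≤ 1 / 128)
  {δ : ℝ} (hδ : 0 ≤ δ) (hδmax : δ ≤ 1 / (12288 * ((2 * (d * L) + L + L : ℕ) : ℝ)))
  (hUU' : ∀ b : Bond d (fineP L m), ‖((U b : 𝔸ˣ) : 𝔸) - ((U' b : 𝔸ˣ) : 𝔸)‖ ≤ δ)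
  {W : Type*} [NormedAddCommGroup W] [InnerProductSpace ℂ W] (φ : W ≃ₗ[ℂ] 𝔸) {c₀ c₁ : ℝ} [Fact (0 < c₀)] [Fact (0 < c₁)]
  {Mφ Mφ' : ℝ} (hMφ : 0 ≤ Mφ) (hφ : ∀ w, ‖φ w‖ ≤ Mφ * ‖w‖) (hMφ' : 0 ≤ Mφ') (hφ' : ∀ X, ‖φ.symm X‖ ≤ Mφ' * ‖X‖)

include hU1' hε' hU'ε hε'reg hδ hδmax hUU' hMφ hφ hMφ' hφ' in
/-- **THE TWO-BACKGROUND `δ_Q`-LETTER IN THE SMALL-BOND BALL**: for unit-bounded `U′` with `‖U′(b) − 1‖ ≤ ε′`, `2(d+1)L·ε′ ≤ 1∕128` (its extended block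
loops are then `2(d+1)Lε′`-regular, `B9Eq315QLipschitz.norm_Wcx_sub_one_le`) and `U` with `‖U(b) − U′(b)‖ ≤ δ ≤ 1∕(12288N)` (§1: `‖U(b)U′(b)⁻¹ − 1‖ ≤ δ`):
`‖Q(U)f − Q(U′)f‖ ≤ M_φ′·M_φ·√(c₁·|bonds of T^{(1)}|∕c₀)·75497472(d+1)N·δ·‖f‖` on the weighted carriers — the form the NE9 chain's small-bond ball
(`‖U(b) − 1‖ ≤ ε ≤ ε₃ ≤ ε_reg(d,L)`) discharges for both backgrounds. [cite: Balaban1985BackgroundPropagators, (3.78)–(3.79) p.406, Thm 3.11 p.416; Balaban1985Averaging, Proposition 7 p.43] -/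
theorem norm_QtorusW_sub_QtorusW_le_of_bonds (f : BondL2K ℂ d (fineP L m) c₀ W) :
    ‖QtorusW L m hL φ U hα1 hU1 hreg (c₁ := c₁) f - QtorusW L m hL φ U' hα1' hU1' hreg' (c₁ := c₁) f‖
      ≤ Mφ' * Mφ * Real.sqrt (c₁ * Fintype.card (Bond d m) / c₀) *
          (75497472 * ((d : ℝ) + 1) * ((2 * (d * L) + L + L : ℕ) : ℝ) * δ) * ‖f‖ := by
  -- the base's extended block loops are `2(d+1)Lε′`-regular, read off its bonds
  have hU'p : ∀ (x : Site d) (κ : Fin d), ‖((perCfg (fineP L m) U' x κ : 𝔸ˣ) : 𝔸) - 1‖ ≤ ε' := fun x κ => hU'ε _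
  have hregε : ∀ (y : TSite d m) (κ : Fin d) (r : Fin d → Fin L),
      ‖((Wcx L (perCfg (fineP L m) U') (cornerSite L y) κ (boxVec L r) : 𝔸ˣ) : 𝔸) - 1‖ ≤ 2 * (d + 1) * L * ε' :=
    fun y κ r => norm_Wcx_sub_one_le hU1' hU'p L (cornerSite L y) κ r hε'
  -- the closeness letter from the bondwise distance (`U′(b) ∈ U1` through the extension at an integer lift of `b`)
  have hU1b : ∀ b : Bond d (fineP L m), U' b ∈ U1 𝔸 := fun b => by
    have h := hU1' (fun i => ((b.1 i : ℕ) : ℤ)) b.2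
    have e : perSite (fineP L m) (fun i => ((b.1 i : ℕ) : ℤ)) = b.1 := by
      funext i
      apply Fin.ext
      simp only [perSite]
      have hlt : ((b.1 i : ℕ) : ℤ) < (fineP L m i : ℤ) := by exact_mod_cast (b.1 i).isLt
      have h0 : (0 : ℤ) ≤ ((b.1 i : ℕ) : ℤ) := by positivity
      rw [Int.emod_eq_of_lt h0 hlt, Int.toNat_natCast]
    rw [perCfg_apply, e] at h
    exact h
  have hUδ : ∀ b : Bond d (fineP L m), ‖((U b : 𝔸ˣ) : 𝔸) * (((U' b)⁻¹ : 𝔸ˣ) : 𝔸) - 1‖ ≤ δ := fun b =>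
    (norm_mul_inv_sub_one_le (hU1b b)).trans (hUU' b)
  -- §5 with the base's regularity letter `2(d+1)Lε′ ≤ 1∕128` (the value of `QtorusW … U′ …` does not depend on the letters it carries)
  have h := norm_QtorusW_sub_QtorusW_le L m hL U hα1 hU1 hreg U' (α' := 2 * (d + 1) * L * ε') (hε'reg.trans (by norm_num)) hU1' hregε
    hε'reg hδ hδmax hUδ φ (c₀ := c₀) (c₁ := c₁) hMφ hφ hMφ' hφ' f
  exact h

end SmallBonds

end Literature.MathematicalPhysics.QuantumFieldTheory.Balaban1983to89.B9Eq379QLipschitzGeneral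

end
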